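import Literature.MathematicalPhysics.QuantumFieldTheory.Balaban1983to89.B9Cor38WholeDir
import Literature.MathematicalPhysics.QuantumFieldTheory.Balaban1983to89.B9Thm39WholeBlkViaDatum

/-!
# `Balaban1983to89.B9Cor38WholeRel` — Corollary 3.8's (3.94) with the walk reading's support clause RELATIVE TO A BLOCK
# EQUIVALENCE (`WalkReading.OKRel`): the two localisation lines of `B9Cor38Whole.term_W38OfOps_le` (l.245) and
# `B9Cor38WholeDir.term_W38OfOpsDir_le` (l.179) redone class-relative, the class multiplicity folded into the O(1) of (3.94)

T. Bałaban, *Propagators for lattice gauge theories in a background field*, Commun. Math. Phys. **99** (1985) 389–434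
[`Balaban1985BackgroundPropagators`, "B9"], Cor. 3.8 (3.91)–(3.94) p. 410, Thm 3.7 (3.90) p. 409, (3.89) p. 409, (3.39) ∕ (3.42)
p. 397, Cor. 3.6 p. 408; [4] = T. Bałaban, *Propagators and renormalization transformations for lattice gauge theories. II*,
Commun. Math. Phys. **96** (1984) 223–250 [`Balaban1984PropagatorsII`], (2.51)–(2.52) p. 232, Lemma 2.1 (2.59)–(2.61) pp. 233–234.

statement-level skeleton of published theorems with citation tags; proofs where landed; nothing here is a claim about the
Yang–Mills mass gap

WHY THIS FILE (cell `pub-ymgap`, Track A node N06 [B9]; dag-n06-d g14 WORD-W1, bus l.42852; node00-def-Y g25 RULING (A), bus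
l.42897; seat `pub-ymgap-dag-n06-c` g16).  The strict reading clause `B9Cor38Whole.WalkReading.OK.off` — *supp λ ⊂ Δ(y′) ⇒ `ev λ`
vanishes at every model point x with `blk x ≠ y′`* — is UNSATISFIABLE by a faithful evaluation when several sites of the geometry
share one carrier block (at the record the ≤ d + 1 index bonds at one base site do: `B9CoRealizesRelAtLetters.RelB`), exactly the
one-fibre defect referee dag-ref-A READ-18 found in the co-readings (repaired there by `B9CoRealizesRel.CoRealizesRel`).  The ruled
repair is the SAME for the walk reading: `WalkReading.OKRel rd blk Rel` asks `ev λ` to vanish only at the points x with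
`¬ Rel (blk x) y′`; the strict schema is the case `Rel := Eq` (`WalkReading.OK.okRel`, `okRel_eq_iff`).  The (3.94) bound then reads
the argument `ev λ = Σ_{y″} Δ(y″)(ev λ)` ([4] (2.52)) with the pieces outside the class of y′ vanishing, each piece block-supported of
size |λ|, the walk majorant of `B9Thm37Glue.cor38_walk_of_342` ∕ `B9Thm37Sum.cor38_walk_majorant` piece by piece, the distance (3.93)
saturated on the class (`B9Thm39WholeBlkViaDatum.minLen_congr_right`, from d(a, b) = d(a, b′) for `Rel b b′`) and the class count ≦ m
(`abs_apply_le_of_hasMajorant_rel`): the printed O(1) = B₀ of (3.94) becomes m·B₀ — ★ `term_W38OfOps_le_okRel`,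
★ `term_W38OfOpsDir_le_okRel`.  The whole printed leaves and the record-geometry faces are `B9Cor38WholeRelFaces`.

HONEST SCOPE.  Kernel bookkeeping: one generic localisation lemma ([4] (2.51)–(2.52) with a class count) and the re-threading of
this lineage's one-member (3.94) bounds through it; Corollary 3.6's blocks, the letters' structure, the sizes and (2.61) remain
HYPOTHESES of printed shape; nothing of [B9] or [4] asserted; COUNT-NEUTRAL; N06 NOT discharged; one finite lattice programme —
nothing continuum, nothing about OS positivity or the mass gap.
-/

namespace Literature.MathematicalPhysics.QuantumFieldTheory.Balaban1983to89.B9Cor38WholeRel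

open Literature.MathematicalPhysics.QuantumFieldTheory.Balaban1983to89
open Finset B6RandomWalk B6RandomWalkHom B9Thm37Sum B9Thm34Ext B9Thm37Glue B9Thm37Whole B9Cor38Whole B9Cor38WholeDir
open B9RWSums346SecondDiff B9RWSums346SecondDiffGp B9Thm37WholeDir B9Thm37GlueDir B9Thm37KLetterDir

noncomputable section

/-! ## §0 The relative reading clause and the generic class-relative localisation lemma -/

section Schema

variable {g : B9.Geometry} {B : B9.Backgrounds} {X ι : Type}

/-- **The reading clauses of the evaluation RELATIVE TO A BLOCK EQUIVALENCE `Rel` ON THE SITES** (the repaired form of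
`B9Cor38Whole.WalkReading.OK`, node00-def-Y RULING (A) on WORD-W1; (3.39) ∕ (3.42) p. 397): supp λ ⊂ Δ(y′) ⇒ `ev λ` vanishes at
the model points x with `¬ Rel (blk x) y′`; |ev λ| ≦ |λ| pointwise; |λ| ≧ 0.  A hypothesis schema; `Rel := Eq` is the strict form
(`WalkReading.OK.okRel`).  Declared into the structure's namespace for dot-notation.
[cite: Balaban1985BackgroundPropagators, (3.39) + (3.42) p.397] -/
structure _root_.Literature.MathematicalPhysics.QuantumFieldTheory.Balaban1983to89.B9Cor38Whole.WalkReading.OKRel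
    (rd : WalkReading g B X ι) (blk : X → g.Site) (Rel : g.Site → g.Site → Prop) : Prop where
  off : ∀ (lam : g.Loc) (y' : g.Site), g.suppIn lam y' → ∀ x, ¬ Rel (blk x) y' → rd.ev lam x = 0
  bound : ∀ (lam : g.Loc) (x : X), |rd.ev lam x| ≤ g.supNorm lam
  norm_nonneg : ∀ lam : g.Loc, 0 ≤ g.supNorm lam

/-- The strict reading clauses give the relative ones for every REFLEXIVE relation (in particular `Rel := Eq`): nothing
already landed on `WalkReading.OK` is lost. [cite: Balaban1985BackgroundPropagators, (3.42) p.397, bookkeeping] -/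
theorem _root_.Literature.MathematicalPhysics.QuantumFieldTheory.Balaban1983to89.B9Cor38Whole.WalkReading.OK.okRel
    {rd : WalkReading g B X ι} {blk : X → g.Site} (h : rd.OK blk) (Rel : g.Site → g.Site → Prop)
    (hrefl : ∀ a, Rel a a) : rd.OKRel blk Rel :=
  ⟨fun lam y' hs x hx => h.off lam y' hs x fun he => hx (he ▸ hrefl _), h.bound, h.norm_nonneg⟩

/-- At `Rel := Eq` the relative clauses ARE the strict ones. [cite: Balaban1985BackgroundPropagators, (3.42) p.397, bookkeeping] -/
theorem okRel_eq_iff (rd : WalkReading g B X ι) (blk : X → g.Site) : rd.OKRel blk Eq ↔ rd.OK blk :=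
  ⟨fun h => ⟨h.off, h.bound, h.norm_nonneg⟩, fun h => h.okRel Eq fun _ => rfl⟩

/-- The walk factor of (3.94) is nonnegative for O(1), O(M^{−1/2}) ≧ 0, M > 0.
[cite: Balaban1985BackgroundPropagators, (3.94) p.410, bookkeeping] -/
theorem walkFactor_nonneg {C c M δ : ℝ} (hC : 0 ≤ C) (hc : 0 ≤ c) (hM : 0 < M) (n : ℕ) (dω : ℝ) :
    0 ≤ B9.walkFactor C c M δ n dω := by
  simp only [B9.walkFactor]
  exact mul_nonneg (mul_nonneg (mul_nonneg hC (pow_nonneg (mul_nonneg hc (Real.rpow_nonneg hM.le _)) _))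
    (Real.rpow_nonneg hM.le _)) (Real.exp_nonneg _)

/-- Monotonicity of the walk factor of (3.94) in its O(1). [cite: Balaban1985BackgroundPropagators, (3.94) p.410, bookkeeping] -/
theorem walkFactor_le_walkFactor {C C' c M δ : ℝ} (hCC' : C ≤ C') (hc : 0 ≤ c) (hM : 0 < M) (n : ℕ) (dω : ℝ) :
    B9.walkFactor C c M δ n dω ≤ B9.walkFactor C' c M δ n dω := by
  have h1 := walkFactor_nonneg (δ := δ) zero_le_one hc hM n dω
  have e : ∀ D : ℝ, B9.walkFactor D c M δ n dω = D * B9.walkFactor 1 c M δ n dω := fun D => by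
    simp only [B9.walkFactor]; ring
  rw [e C, e C']
  exact mul_le_mul_of_nonneg_right hCC' h1

/-- The printed split (cM⁻¹)ⁿ = (cM^{−1/2})ⁿM^{−n/2} of (3.92) ⇒ (3.94) (`B9.split_small_factor`) with a multiplicity m in front:
m·(B₀L²θⁿe^{−r·d}) ≦ L²·walkFactor(mB₀, c, M, 2r, n, d) for θ ≦ cM⁻¹. [cite: Balaban1985BackgroundPropagators, (3.92)–(3.94) p.410, bookkeeping] -/
theorem mul_tail_le_walkFactor {m B₀ L2 θ c M r dω : ℝ} (n : ℕ) (hm : 0 ≤ m) (hB₀ : 0 ≤ B₀) (hL2 : 0 ≤ L2) (hθ : 0 ≤ θ)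
    (hM : 0 < M) (hθc : θ ≤ c * M⁻¹) :
    m * (B₀ * L2 * θ ^ n * Real.exp (-(r * dω))) ≤ L2 * B9.walkFactor (m * B₀) c M (2 * r) n dω := by
  have hpow : θ ^ n ≤ (c * M⁻¹) ^ n := pow_le_pow_left₀ hθ hθc n
  have hexp : Real.exp (-(r * dω)) = Real.exp (-(2 * r / 2 * dω)) := by congr 1; ring
  calc m * (B₀ * L2 * θ ^ n * Real.exp (-(r * dω)))
      ≤ m * (B₀ * L2 * (c * M⁻¹) ^ n * Real.exp (-(r * dω))) :=
        mul_le_mul_of_nonneg_left (mul_le_mul_of_nonneg_right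
          (mul_le_mul_of_nonneg_left hpow (mul_nonneg hB₀ hL2)) (Real.exp_nonneg _)) hm
    _ = L2 * B9.walkFactor (m * B₀) c M (2 * r) n dω := by
        rw [B9.split_small_factor c M hM n, hexp]
        simp only [B9.walkFactor]
        ring

variable [Fintype g.Site]

/-- ★ **[4]-(2.51) MAJORANT + CLASS-RELATIVE SUPPORT ⇒ THE POINTWISE BOUND WITH THE CLASS MULTIPLICITY** (the single-lattice
form of `B9CoRealizesRel.le_of_hasMajorantHom_of_coRealizesRel`).  If T has the majorant K ≧ 0 (w.r.t. `blk`), K(a, ·) is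
saturated on the `Rel`-class of y′, the class has at most m members, and f is bounded by N ≧ 0 and vanishes at the points x
with `¬ Rel (blk x) y′`, then |(Tf)(x)| ≦ m·K(blk x, y′)·N.  Route: f = Σ_{y″} Δ(y″)f ([4] (2.52)), the pieces outside the
class vanish, each piece is block-supported of size N, the majorant piece by piece, saturation, the class count.
[cite: Balaban1984PropagatorsII, (2.51)–(2.52) p.232] -/
theorem abs_apply_le_of_hasMajorant_rel {R : ℝ} {H : Prop} (blk : X → g.Site) {T : Module.End ℝ (X → ℝ)}
    {K : g.Site → g.Site → ℝ} (hT : HasMajorant (g := toB6 g R H) blk T K) (hK : ∀ a b, 0 ≤ K a b)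
    {Rel : g.Site → g.Site → Prop} [DecidableRel Rel] {y' : g.Site} (hsat : ∀ a b, Rel b y' → K a b = K a y')
    {m : ℕ} (hmult : (Finset.univ.filter (fun y'' => Rel y'' y')).card ≤ m)
    {f : X → ℝ} {N : ℝ} (hN : 0 ≤ N) (hbd : ∀ x, |f x| ≤ N) (hoff : ∀ x, ¬ Rel (blk x) y' → f x = 0) (x : X) :
    |T f x| ≤ (m : ℝ) * K (blk x) y' * N := by
  classical
  have hKN : 0 ≤ K (blk x) y' * N := mul_nonneg (hK _ _) hN
  -- the block decomposition; pieces outside the class of y′ vanish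
  have hdec : f = ∑ y'' : (toB6 g R H).Site, blockPiece (g := toB6 g R H) blk y'' f :=
    (sum_blockPiece (g := toB6 g R H) blk f).symm
  have hzero : ∀ y'' : g.Site, ¬ Rel y'' y' → blockPiece (g := toB6 g R H) blk y'' f = 0 := by
    intro y'' hy''
    funext x'
    by_cases hx' : blk x' = y''
    · simp only [blockPiece, hx', if_true, Pi.zero_apply]
      exact hoff x' (by rw [hx']; exact hy'')
    · simp only [blockPiece, Pi.zero_apply]
      split_ifs with h'
      · exact absurd h' hx'
      · rfl
  have hpiece : ∀ y'' : g.Site, BlockSupp (g := toB6 g R H) blk (blockPiece (g := toB6 g R H) blk y'' f) y'' N :=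
    fun y'' =>
    { nonneg := hN
      bound := fun z hz => by
        simp only [blockPiece, hz, if_true]
        exact hbd z
      off := fun z hz => by simp only [blockPiece, hz, if_false] }
  -- each piece of the class is bounded by K(blk x, y′)·N, the others by 0
  have hterm : ∀ y'' : g.Site, |T (blockPiece (g := toB6 g R H) blk y'' f) x| ≤ if Rel y'' y' then K (blk x) y' * N else 0 := by
    intro y''
    by_cases hr : Rel y'' y'
    · rw [if_pos hr]
      have h1 := hT y'' _ N (hpiece y'') x
      rw [hsat _ _ hr] at h1
      exact h1
    · rw [if_neg hr, hzero y'' hr, map_zero, Pi.zero_apply, abs_zero]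
  have hTf : T f = ∑ y'' : (toB6 g R H).Site, T (blockPiece (g := toB6 g R H) blk y'' f) := by
    conv_lhs => rw [hdec]
    rw [map_sum]
  calc |T f x| = |∑ y'' : (toB6 g R H).Site, T (blockPiece (g := toB6 g R H) blk y'' f) x| := by rw [hTf, Finset.sum_apply]
    _ ≤ ∑ y'' : (toB6 g R H).Site, |T (blockPiece (g := toB6 g R H) blk y'' f) x| := Finset.abs_sum_le_sum_abs _ _
    _ ≤ ∑ y'' : g.Site, (if Rel y'' y' then K (blk x) y' * N else 0) := Finset.sum_le_sum fun y'' _ => hterm y''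
    _ = ((Finset.univ.filter (fun y'' => Rel y'' y')).card : ℝ) * (K (blk x) y' * N) := by
        rw [Finset.sum_ite, Finset.sum_const_zero, add_zero, Finset.sum_const, nsmul_eq_mul]
    _ ≤ (m : ℝ) * (K (blk x) y' * N) := mul_le_mul_of_nonneg_right (by exact_mod_cast hmult) hKN
    _ = (m : ℝ) * K (blk x) y' * N := by ring

end Schema

/-! ## §1 One member: the bound (3.94) at `W38OfOps` and at `W38OfOpsDir` under the relative reading clauses -/

section OneMember

variable {g : B9.Geometry} [Fintype g.Site] [DecidableEq g.Site] {B : B9.Backgrounds} {X Y ι Dir : Type} [Fintype Dir]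

omit [Fintype g.Site] [DecidableEq g.Site] [Fintype Dir] in
/-- A nonnegative pointwise bound on the block bounds the block sup (`Real.iSup_le`). [folklore] -/
private theorem blkSup_le'' (blk : X → g.Site) {f : X → ℝ} {y : g.Site} {c : ℝ} (hc : 0 ≤ c)
    (h : ∀ x, blk x = y → f x ≤ c) : blkSup blk f y ≤ c :=
  Real.iSup_le (fun x => h x.1 x.2) hc

omit [Fintype g.Site] [Fintype Dir] in
/-- The walk majorant `1_{S}(a)B₀len(a)²·θⁿ·e^{−r·d_ω(a,b)}` of (3.91)–(3.92) with d_ω = `minLen` is nonnegative and SATURATED on a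
`Rel`-class in its end point when d(·, b) is (`B9Thm39WholeBlkViaDatum.minLen_congr_right`). [cite: Balaban1985BackgroundPropagators, (3.91)–(3.93) p.410, bookkeeping] -/
theorem walkMaj_nonneg_sat {B₀ θ r : ℝ} (hB₀ : 0 ≤ B₀) (hθ : 0 ≤ θ) (S : Finset g.Site) (Sw : ℕ → Finset g.Site)
    (n : ℕ) (Rel : g.Site → g.Site → Prop) (hRd₂ : ∀ a b b' : g.Site, Rel b b' → g.dist a b = g.dist a b') (y' : g.Site) :
    (∀ a b : g.Site, 0 ≤ (if a ∈ S then B₀ * g.len a ^ 2 else 0) * θ ^ n * Real.exp (-(r * minLen g.dist Sw n a b))) ∧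
    (∀ a b : g.Site, Rel b y' →
      (if a ∈ S then B₀ * g.len a ^ 2 else 0) * θ ^ n * Real.exp (-(r * minLen g.dist Sw n a b)) =
        (if a ∈ S then B₀ * g.len a ^ 2 else 0) * θ ^ n * Real.exp (-(r * minLen g.dist Sw n a y'))) := by
  refine ⟨fun a b => mul_nonneg (mul_nonneg ?_ (pow_nonneg hθ _)) (Real.exp_nonneg _), fun a b hb => ?_⟩
  · split_ifs
    · exact mul_nonneg hB₀ (sq_nonneg _)
    · exact le_rfl
  · rw [B9Thm39WholeBlkViaDatum.minLen_congr_right g.dist (fun z => hRd₂ z b y' hb) n Sw a]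

omit [Fintype Dir] in
/-- ★ **THE BOUND (3.94) at one member and one configuration U, RELATIVE READING CLAUSES** (`B9Cor38Whole.term_W38OfOps_le` with
`hrd : rd.OKRel 𝔬.blk Rel`; p. 410: *"|Δ(y)h_{□₀}G′_{□₀}h_{□₀}Π_{i=1}^n K(h_{□ᵢ})G′_{□ᵢ}h_{□ᵢ}Δ(y′)λ| ≦ O(1)(L^jη)²O(M^{−1/2})^{|ω|}
M^{−1/2|ω|}e^{−(1/2)δ₀d(ω,y,y′)}|Δ(y′)λ| for y ∈ □₀ ∩ Λ_j"*) at the datum `W38OfOps`, with O(1) = m·B₀ (m = the multiplicity of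
a `Rel`-class, d(·, b) saturated on classes), O(M^{−1/2}) = (B₀e^{δ₀ρ}θ₀c₁(α) + 1)M^{−1/2} and ½δ₀′, δ₀′ = 2(1 − α)δ₀: the walk
majorant of `B9Thm37Glue.cor38_walk_of_342` ((3.91)–(3.92)) evaluated on the argument λ through `abs_apply_le_of_hasMajorant_rel`
(the distance (3.93) saturated by `minLen_congr_right`), then `B9.split_small_factor` (`mul_tail_le_walkFactor`).
[cite: Balaban1985BackgroundPropagators, Cor. 3.8 (3.91)–(3.94) p.410 + (3.89) p.409; Balaban1984PropagatorsII, Lemma 2.1 (2.61) p.234 + (2.51)–(2.52) p.232] -/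
theorem term_W38OfOps_le_okRel [Fintype X] [DecidableEq X] [Fintype ι] (𝔬 : Ops g B X Y ι) (rd : WalkReading g B X ι)
    (R : ℝ) (H : Prop) (C δ : ℝ) (d : ℕ) (δ₀ α ρ B₀ N N' Cℓ θ₀ : ℝ) (κ : Sizes) (U : B.Cfg)
    (Rel : g.Site → g.Site → Prop) [DecidableRel Rel] (m : ℕ)
    (hRd₂ : ∀ a b b' : g.Site, Rel b b' → g.dist a b = g.dist a b')
    (hmult : ∀ y' : g.Site, (Finset.univ.filter (fun y'' => Rel y'' y')).card ≤ m)
    (hB₀ : 0 ≤ B₀) (hδ₀ : 0 ≤ δ₀) (hα : 0 ≤ α) (hα1 : α ≤ 1) (hθ₀ : 0 ≤ θ₀) (hM : 0 < g.M)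
    (hs : StaticOK 𝔬 ρ N N' Cℓ κ) (hκ : κ.Nonneg) (hrow : κ.kP + κ.kC ≤ θ₀ * g.M⁻¹)
    (h261 : Ineq261 d (toB6 g R H) δ₀ α) (hrd : rd.OKRel 𝔬.blk Rel) (hl : Local342 𝔬 R H B₀ δ₀ U)
    (hi : Identities 𝔬 R H U) (w : ℕ × (ℕ → ι)) (lam : g.Loc) (y y' : g.Site) (hy : y ∈ 𝔬.S (w.2 0))
    (hlam : g.suppIn lam y') :
    (W38OfOps 𝔬 rd R H C δ).term U w lam y ≤
      g.len y ^ 2 * B9.walkFactor ((m : ℝ) * B₀) (B₀ * Real.exp (δ₀ * ρ) * θ₀ * B6.c1 d δ₀ α + 1) g.M (2 * ((1 - α) * δ₀))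
        ((W38OfOps 𝔬 rd R H C δ).wlen w) ((W38OfOps 𝔬 rd R H C δ).wdist w y y') * g.supNorm lam := by
  obtain ⟨n, ω⟩ := w
  have hlen : ∀ z : g.Site, 0 ≤ g.len z := fun z => (hs.lenpos z).le
  have htri : Triangle254 (toB6 g R H) := fun a b c => hs.tri a b c
  have hk12 : 0 ≤ κ.kP + κ.kC := add_nonneg hκ.kP hκ.kC
  have hαδ : 0 ≤ α * δ₀ := mul_nonneg hα hδ₀
  have h1αδ : 0 ≤ (1 - α) * δ₀ := mul_nonneg (by linarith) hδ₀
  have hc1 : 0 ≤ B6.c1 d δ₀ α := c1_nonneg d δ₀ α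
  have hm : (0 : ℝ) ≤ m := Nat.cast_nonneg m
  have hθ : 0 ≤ B₀ * Real.exp (δ₀ * ρ) * (κ.kP + κ.kC) := mul_nonneg (mul_nonneg hB₀ (Real.exp_nonneg _)) hk12
  have hc0 : 0 ≤ B₀ * Real.exp (δ₀ * ρ) * θ₀ * B6.c1 d δ₀ α :=
    mul_nonneg (mul_nonneg (mul_nonneg hB₀ (Real.exp_nonneg _)) hθ₀) hc1
  -- (3.91)–(3.92): the term operator has the majorant 1_{S_{□₀}}(a)B₀(L^jη)²(θc₁)ⁿe^{−(1−α)δ₀d_ω(a,b)}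
  have hmaj := cor38_walk_of_342 (R := R) (H := H) 𝔬.blk 𝔬.blkY d δ₀ α ρ B₀ κ.kP κ.kC 𝔬.S 𝔬.S' 𝔬.h 𝔬.KP 𝔬.KC ω
    (walkOps 𝔬 U ω) (walkSets 𝔬 ω) (minLen g.dist (walkSets 𝔬 ω) n) n hB₀ hδ₀ hk12 hs.dnn hαδ h1αδ htri hlen h261
    hs.hh hs.hS hs.KP_nonneg hs.KP_loc hs.KP_row hs.KC_nonneg hs.KC_loc hs.KC_row hl.e0 hl.e1 hi.hP hi.hC
    (by simp only [walkOps, if_true])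
    (fun k hk _ => by
      have hk0 : k ≠ 0 := by omega
      simp only [walkOps, hk0, if_false])
    (by simp only [walkSets, if_true])
    (fun k hk _ => by
      have hk0 : k ≠ 0 := by omega
      simp only [walkSets, hk0, if_false])
    (fun a b => LB_minLen g.dist n (walkSets 𝔬 ω) a b)
  obtain ⟨hKnn, hsat⟩ := walkMaj_nonneg_sat (r := (1 - α) * δ₀) hB₀ (mul_nonneg hθ hc1) (𝔬.S (ω 0)) (walkSets 𝔬 ω) n
    Rel hRd₂ y'
  -- evaluate at the argument λ: supp λ ⊂ Δ(y′) read relative to `Rel`, |ev λ| ≦ |λ|, at most m blocks in the class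
  have hpt : ∀ x, 𝔬.blk x = y → |lprod (walkOps 𝔬 U ω) n (rd.ev lam) x| ≤
      (m : ℝ) * (B₀ * g.len y ^ 2 * ((B₀ * Real.exp (δ₀ * ρ) * (κ.kP + κ.kC)) * B6.c1 d δ₀ α) ^ n *
        Real.exp (-((1 - α) * δ₀ * (minLen g.dist (walkSets 𝔬 ω) n y y')))) * g.supNorm lam := by
    intro x hx
    have h := abs_apply_le_of_hasMajorant_rel (R := R) (H := H) 𝔬.blk hmaj hKnn hsat (hmult y') (hrd.norm_nonneg lam)
      (hrd.bound lam) (hrd.off lam y' hlam) x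
    rw [hx, if_pos hy] at h
    exact h
  -- (θc₁)ⁿ ≦ (cM⁻¹)ⁿ = (cM^{−1/2})ⁿM^{−n/2}, θ = B₀e^{δ₀ρ}(k_P + k_C), c = B₀e^{δ₀ρ}θ₀c₁ + 1
  have hθc : (B₀ * Real.exp (δ₀ * ρ) * (κ.kP + κ.kC)) * B6.c1 d δ₀ α ≤
      (B₀ * Real.exp (δ₀ * ρ) * θ₀ * B6.c1 d δ₀ α + 1) * g.M⁻¹ := by
    have hMinv : 0 ≤ g.M⁻¹ := inv_nonneg.mpr hM.le
    have h1 : (B₀ * Real.exp (δ₀ * ρ) * (κ.kP + κ.kC)) ≤ B₀ * Real.exp (δ₀ * ρ) * (θ₀ * g.M⁻¹) :=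
      mul_le_mul_of_nonneg_left hrow (mul_nonneg hB₀ (Real.exp_nonneg _))
    calc (B₀ * Real.exp (δ₀ * ρ) * (κ.kP + κ.kC)) * B6.c1 d δ₀ α
        ≤ B₀ * Real.exp (δ₀ * ρ) * (θ₀ * g.M⁻¹) * B6.c1 d δ₀ α := mul_le_mul_of_nonneg_right h1 hc1
      _ = (B₀ * Real.exp (δ₀ * ρ) * θ₀ * B6.c1 d δ₀ α) * g.M⁻¹ := by ring
      _ ≤ (B₀ * Real.exp (δ₀ * ρ) * θ₀ * B6.c1 d δ₀ α + 1) * g.M⁻¹ := mul_le_mul_of_nonneg_right (by linarith) hMinv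
  have hfac := mul_tail_le_walkFactor (r := (1 - α) * δ₀) (dω := minLen g.dist (walkSets 𝔬 ω) n y y') n hm hB₀
    (sq_nonneg (g.len y)) (mul_nonneg hθ hc1) hM hθc
  -- assemble: the block sup is below the (nonnegative) common bound
  have hrhs : 0 ≤ g.len y ^ 2 * B9.walkFactor ((m : ℝ) * B₀) (B₀ * Real.exp (δ₀ * ρ) * θ₀ * B6.c1 d δ₀ α + 1) g.M
      (2 * ((1 - α) * δ₀)) n (minLen g.dist (walkSets 𝔬 ω) n y y') * g.supNorm lam :=
    mul_nonneg (mul_nonneg (sq_nonneg _) (walkFactor_nonneg (mul_nonneg hm hB₀) (by linarith) hM _ _))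
      (hrd.norm_nonneg lam)
  show blkSup 𝔬.blk (fun x => |lprod (walkOps 𝔬 U ω) n (rd.ev lam) x|) y ≤
    g.len y ^ 2 * B9.walkFactor ((m : ℝ) * B₀) (B₀ * Real.exp (δ₀ * ρ) * θ₀ * B6.c1 d δ₀ α + 1) g.M (2 * ((1 - α) * δ₀)) n
      (minLen g.dist (walkSets 𝔬 ω) n y y') * g.supNorm lam
  refine blkSup_le'' 𝔬.blk hrhs fun x hx => (hpt x hx).trans ?_
  exact mul_le_mul_of_nonneg_right hfac (hrd.norm_nonneg lam)

/-- ★ **(OVER THE DIRECTION LETTERS.) THE BOUND (3.94) at one member and one configuration U, RELATIVE READING CLAUSES**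
(`B9Cor38WholeDir.term_W38OfOpsDir_le` with `hrd : rd.OKRel 𝔬.blk Rel`): at the datum `W38OfOpsDir`, O(1) = m·B₀, the factor
majorants from `B9Thm37KLetterDir.h389_dir` (`DirSupSq37`, `Identities₂`) knit by `B9Thm37Sum.cor38_walk_majorant`, evaluated on λ
through `abs_apply_le_of_hasMajorant_rel`; everything else as `term_W38OfOps_le_okRel`.
[cite: Balaban1985BackgroundPropagators, Cor. 3.8 (3.91)–(3.94) p.410 + (3.89) p.409; Balaban1984PropagatorsII, Lemma 2.1 (2.61) p.234 + (2.51)–(2.52) p.232] -/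
theorem term_W38OfOpsDir_le_okRel [Fintype X] [DecidableEq X] [Fintype Y] [Fintype ι] (𝔬 : Ops g B X Y ι)
    (𝔡 : DirOps37 𝔬 Dir) (𝔩 : DirLetters37 𝔬 Dir) (rd : WalkReading g B X ι) (R : ℝ) (H : Prop) (C δ : ℝ) (d : ℕ)
    (δ₀ α ρ B₀ N N' Cℓ θ₀ : ℝ) (κ : Sizes) (U : B.Cfg)
    (Rel : g.Site → g.Site → Prop) [DecidableRel Rel] (m : ℕ)
    (hRd₂ : ∀ a b b' : g.Site, Rel b b' → g.dist a b = g.dist a b')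
    (hmult : ∀ y' : g.Site, (Finset.univ.filter (fun y'' => Rel y'' y')).card ≤ m)
    (hB₀ : 0 ≤ B₀) (hδ₀ : 0 ≤ δ₀) (hα : 0 ≤ α) (hα1 : α ≤ 1) (hθ₀ : 0 ≤ θ₀) (hM : 0 < g.M)
    (hs : StaticOK 𝔬 ρ N N' Cℓ κ) (hκ : κ.Nonneg) (hrow : κ.kP + κ.kC ≤ θ₀ * g.M⁻¹)
    (h261 : Ineq261 d (toB6 g R H) δ₀ α) (hrd : rd.OKRel 𝔬.blk Rel) (hl : Local342 𝔬 R H B₀ δ₀ U)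
    (hT : DirSupSq37 𝔬 𝔡 R H U) (hi : Identities₂ 𝔬 𝔡 𝔩 R H U) (w : ℕ × (ℕ → ι)) (lam : g.Loc) (y y' : g.Site)
    (hy : y ∈ 𝔬.S (w.2 0)) (hlam : g.suppIn lam y') :
    (W38OfOpsDir 𝔬 𝔡 𝔩 rd R H C δ).term U w lam y ≤
      g.len y ^ 2 * B9.walkFactor ((m : ℝ) * B₀) (B₀ * Real.exp (δ₀ * ρ) * θ₀ * B6.c1 d δ₀ α + 1) g.M (2 * ((1 - α) * δ₀))
        ((W38OfOpsDir 𝔬 𝔡 𝔩 rd R H C δ).wlen w) ((W38OfOpsDir 𝔬 𝔡 𝔩 rd R H C δ).wdist w y y') * g.supNorm lam := by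
  obtain ⟨n, ω⟩ := w
  have hk12 : 0 ≤ κ.kP + κ.kC := add_nonneg hκ.kP hκ.kC
  have hαδ : 0 ≤ α * δ₀ := mul_nonneg hα hδ₀
  have h1αδ : 0 ≤ (1 - α) * δ₀ := mul_nonneg (by linarith) hδ₀
  have hc1 : 0 ≤ B6.c1 d δ₀ α := c1_nonneg d δ₀ α
  have hm : (0 : ℝ) ≤ m := Nat.cast_nonneg m
  have hθ : 0 ≤ B₀ * Real.exp (δ₀ * ρ) * (κ.kP + κ.kC) := mul_nonneg (mul_nonneg hB₀ (Real.exp_nonneg _)) hk12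
  have hc0 : 0 ≤ B₀ * Real.exp (δ₀ * ρ) * θ₀ * B6.c1 d δ₀ α :=
    mul_nonneg (mul_nonneg (mul_nonneg hB₀ (Real.exp_nonneg _)) hθ₀) hc1
  -- (3.91)–(3.92) over the direction letters, as `term_W38OfOpsDir_le`
  have hT0 : HasMajorant (g := toB6 g R H) 𝔬.blk (walkOpsDir 𝔬 𝔡 𝔩 U ω 0)
      (fun (a b : g.Site) => if a ∈ walkSets 𝔬 ω 0 then B₀ * g.len a ^ 2 * Real.exp (-(δ₀ * g.dist a b)) else 0) := by
    simp only [walkOpsDir, walkSets, if_true]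
    exact hasMajorant_sandwich_local (R := R) (H := H) 𝔬.blk (hl.e0 (ω 0)) (𝔬.h (ω 0)) (hs.hh (ω 0)) (𝔬.S (ω 0))
      (hs.hS (ω 0))
  have h389 := h389_dir (R := R) (H := H) (κ := κ) hB₀ hδ₀ hs hl hT hi
  have hRk : ∀ k, 1 ≤ k → k ≤ n → HasMajorant (g := toB6 g R H) 𝔬.blk (walkOpsDir 𝔬 𝔡 𝔩 U ω k)
      (fun (a b : g.Site) => if a ∈ walkSets 𝔬 ω k then
        B₀ * Real.exp (δ₀ * ρ) * (κ.kP + κ.kC) * Real.exp (-(δ₀ * g.dist a b)) else 0) := by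
    intro k hk _
    have hk0 : k ≠ 0 := by omega
    simp only [walkOpsDir, walkSets, hk0, if_false]
    exact h389 (ω k)
  have hmaj' := cor38_walk_majorant (R := R) (H := H) 𝔬.blk d δ₀ α (B₀ * Real.exp (δ₀ * ρ) * (κ.kP + κ.kC)) B₀
    (walkSets 𝔬 ω) (walkOpsDir 𝔬 𝔡 𝔩 U ω) (minLen g.dist (walkSets 𝔬 ω) n) n hB₀ hθ hs.dnn hαδ h1αδ h261 hT0 hRk
    (fun a b => LB_minLen g.dist n (walkSets 𝔬 ω) a b)
  have hmaj : HasMajorant (g := toB6 g R H) 𝔬.blk (lprod (walkOpsDir 𝔬 𝔡 𝔩 U ω) n)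
      (fun (a b : g.Site) => (if a ∈ 𝔬.S (ω 0) then B₀ * g.len a ^ 2 else 0) *
        (B₀ * Real.exp (δ₀ * ρ) * (κ.kP + κ.kC) * B6.c1 d δ₀ α) ^ n *
          Real.exp (-((1 - α) * δ₀ * minLen g.dist (walkSets 𝔬 ω) n a b))) := by
    refine hasMajorant_mono (g := toB6 g R H) 𝔬.blk hmaj' fun a b => le_of_eq ?_
    simp only [walkSets, if_true]
  obtain ⟨hKnn, hsat⟩ := walkMaj_nonneg_sat (r := (1 - α) * δ₀) hB₀ (mul_nonneg hθ hc1) (𝔬.S (ω 0)) (walkSets 𝔬 ω) n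
    Rel hRd₂ y'
  -- evaluate at the argument λ, relative to `Rel`
  have hpt : ∀ x, 𝔬.blk x = y → |lprod (walkOpsDir 𝔬 𝔡 𝔩 U ω) n (rd.ev lam) x| ≤
      (m : ℝ) * (B₀ * g.len y ^ 2 * ((B₀ * Real.exp (δ₀ * ρ) * (κ.kP + κ.kC)) * B6.c1 d δ₀ α) ^ n *
        Real.exp (-((1 - α) * δ₀ * (minLen g.dist (walkSets 𝔬 ω) n y y')))) * g.supNorm lam := by
    intro x hx
    have h := abs_apply_le_of_hasMajorant_rel (R := R) (H := H) 𝔬.blk hmaj hKnn hsat (hmult y') (hrd.norm_nonneg lam)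
      (hrd.bound lam) (hrd.off lam y' hlam) x
    rw [hx, if_pos hy] at h
    exact h
  -- (θc₁)ⁿ ≦ (cM⁻¹)ⁿ = (cM^{−1/2})ⁿM^{−n/2}
  have hθc : (B₀ * Real.exp (δ₀ * ρ) * (κ.kP + κ.kC)) * B6.c1 d δ₀ α ≤
      (B₀ * Real.exp (δ₀ * ρ) * θ₀ * B6.c1 d δ₀ α + 1) * g.M⁻¹ := by
    have hMinv : 0 ≤ g.M⁻¹ := inv_nonneg.mpr hM.le
    have h1 : (B₀ * Real.exp (δ₀ * ρ) * (κ.kP + κ.kC)) ≤ B₀ * Real.exp (δ₀ * ρ) * (θ₀ * g.M⁻¹) :=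
      mul_le_mul_of_nonneg_left hrow (mul_nonneg hB₀ (Real.exp_nonneg _))
    calc (B₀ * Real.exp (δ₀ * ρ) * (κ.kP + κ.kC)) * B6.c1 d δ₀ α
        ≤ B₀ * Real.exp (δ₀ * ρ) * (θ₀ * g.M⁻¹) * B6.c1 d δ₀ α := mul_le_mul_of_nonneg_right h1 hc1
      _ = (B₀ * Real.exp (δ₀ * ρ) * θ₀ * B6.c1 d δ₀ α) * g.M⁻¹ := by ring
      _ ≤ (B₀ * Real.exp (δ₀ * ρ) * θ₀ * B6.c1 d δ₀ α + 1) * g.M⁻¹ := mul_le_mul_of_nonneg_right (by linarith) hMinv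
  have hfac := mul_tail_le_walkFactor (r := (1 - α) * δ₀) (dω := minLen g.dist (walkSets 𝔬 ω) n y y') n hm hB₀
    (sq_nonneg (g.len y)) (mul_nonneg hθ hc1) hM hθc
  have hrhs : 0 ≤ g.len y ^ 2 * B9.walkFactor ((m : ℝ) * B₀) (B₀ * Real.exp (δ₀ * ρ) * θ₀ * B6.c1 d δ₀ α + 1) g.M
      (2 * ((1 - α) * δ₀)) n (minLen g.dist (walkSets 𝔬 ω) n y y') * g.supNorm lam :=
    mul_nonneg (mul_nonneg (sq_nonneg _) (walkFactor_nonneg (mul_nonneg hm hB₀) (by linarith) hM _ _))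
      (hrd.norm_nonneg lam)
  show blkSup 𝔬.blk (fun x => |lprod (walkOpsDir 𝔬 𝔡 𝔩 U ω) n (rd.ev lam) x|) y ≤
    g.len y ^ 2 * B9.walkFactor ((m : ℝ) * B₀) (B₀ * Real.exp (δ₀ * ρ) * θ₀ * B6.c1 d δ₀ α + 1) g.M (2 * ((1 - α) * δ₀)) n
      (minLen g.dist (walkSets 𝔬 ω) n y y') * g.supNorm lam
  refine blkSup_le'' 𝔬.blk hrhs fun x hx => (hpt x hx).trans ?_
  exact mul_le_mul_of_nonneg_right hfac (hrd.norm_nonneg lam)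

end OneMember

end

end Literature.MathematicalPhysics.QuantumFieldTheory.Balaban1983to89.B9Cor38WholeRel
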